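import Summits.QuantumFields.BalabanUV.T4Continuum.Support.NE7SliceTheoremNL0
import Summits.QuantumFields.BalabanUV.T4Continuum.Support.NE7CurvedSupLetter
import HarnessLib

/-!
# NE7SliceTheoremNL0Curved — (R1″) AT DIMENSION `d + 1 ≥ 2`, THE CURVED SUP LETTER DISCHARGED (memo ROAD-G103 §7 (J3), first file): `NE7SliceTheoremNL0.slice_theorem_nl` with the
# displayed letter (L) `hLet` and its absorption line `hKε` supplied by `NE7CurvedSupLetter.curved_sup_letter` (`∃ K > 0, ∃ ε₁ > 0`, price `M²x ≤ ε₁`) — the pattern of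
# `NE7SliceTheoremFrames.slice_theorem_curved_fm` VERBATIM for the frame-free engine

Cell `pub-balaban`, rung (B)+1 sub-cell t4, lineage `b2b-balaban-t4-ne7-p1`, generation 104 (CRUX PROVER NE7 #1 = OWNER of BINDER row NE7).  Memo `t4/b2b-balaban-t4-ne7-p1-g103/ROAD-G103.md` §7.
WHAT ([folklore]; 0 def, 0 sorry).  **`slice_theorem_curved_nl0`** — every other hypothesis of `slice_theorem_nl` (class at `W`, B7's Prop-4 regime for `W`, `U′` at the radii `b₁` and `2b`, the currency `τ + ω`,
the near-representative `u₀`, the ceilings `e_E, c_E, e_c, δ₀, S`, the radius lines) displayed token for token; conclusion = `slice_theorem_nl`'s (incl. `∀ z, mlog v_{k+1}(X(u⋆)) z = h(u⋆) z`, (1.37) EXACTLY).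
HONEST FRAMING (page 1): assembly of two landed theorems; nothing of Bałaban's asserted; NOT the END currency, NOT NE7; spine 0∕9; finite T⁴ rung (B)+1 — NOT infinite volume, NOT mass gap, NOT BetaPertH,
NOT Clay (continuum YM on T⁴ ⇐ BetaPertH ∧ nine spine estimates, 0/9 proved).
-/

set_option autoImplicit false

open scoped BigOperators Matrix.Norms.L2Operator Topology
open NormedSpace Finset Filter

namespace Summit.QuantumFields.BalabanUV.T4Continuum.NE7SliceTheoremNL0Curved

open Literature.MathematicalPhysics.QuantumFieldTheory.Balaban1983to89
open B7Prop1Explicit B7Prop2Explicit B7Prop3Flat MatrixLog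
open B7Eq92Concrete (vcov)
open T4AveragingDeficitWall (IsUnitaryCfg IsSkewDir SmallField vary curlAt)
open T4AveragingDeficitWallBoundary (IsPeriodicCfg periodBox)
open AveragingDeficitPeriodicCounting (IsPeriodicDir)
open AveragingDeficitTwoLevelPrep (prop1Radius)
open AveragingDeficitMultiLevelPrep (cavgIter LevelSmall tower)
open NE3EnergyShapes (IsUnitarySite IsPeriodicSite)
open NE3RightInverseSupLetters (frameC supC)
open NE3HatInvCurlLetters (supCurlC)
open NE3QbarIterCovLiftPrep (cruxC)
open NE7FrameFreeRightInverse (rightInvW0 supC0 supCurlC0)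
open NE3LinearisedAverageSup (curvSum)
open NE3TangentCovariantTower (framePotW)
open NE3.PairLandauB8Avg (relPert)
open NE7MeanZeroGaugeSliceW (energyBlockLandauW)
open SpreadLift (loopRad)
open NE7SliceIterationState (repLog cornerLog)
open NE7SliceIterationStateNL0 (tangentPartNL0 normalPartNL0 sliceDefectNL0)
open NE7SliceTheoremNL0 (slice_theorem_nl)
open NE7CurvedSupLetter (curved_sup_letter)

noncomputable section

variable {d : ℕ} {n : Type*} [Fintype n] [DecidableEq n]

set_option maxHeartbeats 400000 in
/-- **THE (R1″) SLICE THEOREM AT DIMENSION `d + 1 ≥ 2`, (L) DISCHARGED**: `∃ K > 0, ∃ ε₁ > 0` such that `NE7SliceTheoremNL0.slice_theorem_nl` holds with THIS `K`, without `hLet`∕`hKε`, at the price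
`M²x ≤ ε₁`. [folklore] -/
theorem slice_theorem_curved_nl0 [Nonempty n] (hd : 1 ≤ d) {L : ℕ} (hL : 2 ≤ L) :
    ∃ K : ℝ, 0 < K ∧ ∃ ε₁ : ℝ, 0 < ε₁ ∧ ∀ (k N : ℕ) [NeZero N] (W U' : Site (d + 1) → Fin (d + 1) → (Matrix n n ℂ)ˣ) (x : ℝ)
      (hWu : IsUnitaryCfg W) (hx : 0 ≤ x) (hs : LevelSmall (d + 1) L k x) (hWx : SmallField W x) (hθ : cruxC (d + 1) L * (((L : ℝ) ^ (k + 1)) ^ 2 * x) < 1)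
      (hE : 4 * ((d + 1 : ℕ) : ℝ) ^ 2 * ((L : ℝ) ^ (k + 1) - 1) ^ 2 * x + 16 * ((d + 1 : ℕ) : ℝ) * loopRad (d + 1) L ((prop1Radius (d + 1) L)^[k] x) ≤ 1 / 2),
      IsPeriodicCfg W ((tower L N (k + 1) : ℕ) : ℤ) → IsUnitaryCfg U' → IsPeriodicCfg U' ((tower L N (k + 1) : ℕ) : ℤ) →
      ∀ (κ₀ : Fin (d + 1)) {α₀ αP x' b b₁ ω : ℝ}, 0 < α₀ → C0 (d + 1) * α₀ ≤ 1 / 3 → 4 * α₀ ≤ c2' (d + 1) L → pdev W < α₀ * (((L : ℝ) ^ (k + 1))⁻¹) ^ 2 →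
      Real.exp (4 * (800 * (((d + 1 : ℕ) : ℝ) + 1) ^ 2 * (((d + 1 : ℕ) : ℝ) + 4)) * α₀) * (1 + 8 * (131072 * (((d + 1 : ℕ) : ℝ) + 1) ^ 2) * ((L : ℝ) ^ (k + 1) * b₁)) ≤ 2 →
      2 * ((L : ℝ) ^ (k + 1) * b₁) ≤ c3 (d + 1) L → 100 * ((((d + 1 : ℕ) : ℝ)) * L * ((L : ℝ) ^ (k + 1) * b₁)) ≤ 1 →
      16 * (131072 * (((d + 1 : ℕ) : ℝ) + 1) ^ 2) * ((L : ℝ) ^ (k + 1) * b₁) ≤ 1 → 2048 * (((d + 1 : ℕ) : ℝ)) * ((L : ℝ) ^ (k + 1) * b₁) ≤ 1 →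
      Real.exp (4 * (800 * (((d + 1 : ℕ) : ℝ) + 1) ^ 2 * (((d + 1 : ℕ) : ℝ) + 4)) * α₀) * (1 + 8 * (131072 * (((d + 1 : ℕ) : ℝ) + 1) ^ 2) * ((L : ℝ) ^ (k + 1) * (2 * b))) ≤ 2 →
      2 * ((L : ℝ) ^ (k + 1) * (2 * b)) ≤ c3 (d + 1) L → 100 * ((((d + 1 : ℕ) : ℝ)) * L * ((L : ℝ) ^ (k + 1) * (2 * b))) ≤ 1 →
      16 * (131072 * (((d + 1 : ℕ) : ℝ) + 1) ^ 2) * ((L : ℝ) ^ (k + 1) * (2 * b)) ≤ 1 → 2048 * (((d + 1 : ℕ) : ℝ)) * ((L : ℝ) ^ (k + 1) * (2 * b)) ≤ 1 →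
      0 < αP → C0 (d + 1) * αP ≤ 1 / 3 → 2 * αP ≤ c2' (d + 1) L → 0 ≤ x' → SmallField U' x' → x' < αP * (((L : ℝ) ^ (k + 1))⁻¹) ^ 2 →
      0 ≤ ω → 4 * (56 * ((((d + 1 : ℕ) : ℝ)) * L) ^ 2 + 16 * (131072 * (((d + 1 : ℕ) : ℝ) + 1) ^ 2) * ((((d + 1 : ℕ) : ℝ)) * L)) * ((L : ℝ) ^ (k + 1) * b₁) ≤ ω →
      4 * (((d + 1 : ℕ) : ℝ)) ^ 2 * ((L : ℝ) ^ (k + 1) - 1) ^ 2 * x + 16 * ((d + 1 : ℕ) : ℝ) * loopRad (d + 1) L ((prop1Radius (d + 1) L)^[k] x)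
        + 4 * ((d + 1 : ℕ) : ℝ) * ((((d + 1 : ℕ) : ℝ)) - 1) * ((L : ℝ) ^ (k + 1) - 1) ^ 2 * x ≤ 1 / 2 →
      ((L : ℝ) ^ (k + 1)) ^ 2 * x ≤ ε₁ → ((L : ℝ) ^ (k + 1)) ^ 2 * x ≤ 1 → curvSum (d + 1) L (k + 1) x ≤ 2 / 3 * L → cruxC (d + 1) L * (((L : ℝ) ^ (k + 1)) ^ 2 * x) ≤ 1 / 2 →
      ∀ {τ : ℝ}, 0 ≤ τ → τ + ω ≤ 1 → 30000 * ((d + 1 : ℕ) : ℝ) * τ ≤ 1 →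
      3000000 * (1 + 16 * K) * (1 + ((d + 1 : ℕ) : ℝ)) ^ 3 * (1 + frameC (d + 1) L) * (1 + supC0 (d + 1) L + supCurlC0 (d + 1) L) * (τ + ω) ≤ 1 / 2 →
      ((L : ℝ) ^ (k + 1)) ^ 2 * x ≤ τ → ((L : ℝ) ^ (k + 1)) ^ 2 * x' ≤ τ →
      ∀ {u₀ : Site (d + 1) → (Matrix n n ℂ)ˣ}, IsUnitarySite u₀ → IsPeriodicSite u₀ ((tower L N (k + 1) : ℕ) : ℤ) → (∀ z : Site (d + 1), u₀ ((((L : ℤ) ^ (k + 1))) • z) = 1) →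
      (∀ (y : Site (d + 1)) (κ : Fin (d + 1)), ‖(((W y κ)⁻¹ * gaugeAct u₀ U' y κ : (Matrix n n ℂ)ˣ) : Matrix n n ℂ) - 1‖ ≤ b) → b ≤ 1 / 64 →
      ∀ {eE cE ec δ₀ S : ℝ},
      2 * b + supC0 (d + 1) L / ((L : ℝ) ^ (k + 1) * (1 - cruxC (d + 1) L * (((L : ℝ) ^ (k + 1)) ^ 2 * x)))
        * ((3 + 12 * ((d + 1 : ℕ) : ℝ)) * (L : ℝ) ^ (k + 1) * (2 * b)
          + 2 * ((56 * ((((d + 1 : ℕ) : ℝ)) * L) ^ 2 + 16 * (131072 * (((d + 1 : ℕ) : ℝ) + 1) ^ 2) * ((((d + 1 : ℕ) : ℝ)) * L)) * ((L : ℝ) ^ (k + 1) * (2 * b)) ^ 2)) ≤ eE →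
      (x + x' + 48 * (2 * b) ^ 2) + supCurlC0 (d + 1) L / (((L : ℝ) ^ (k + 1)) ^ 2 * (1 - cruxC (d + 1) L * (((L : ℝ) ^ (k + 1)) ^ 2 * x)))
        * ((3 + 12 * ((d + 1 : ℕ) : ℝ)) * (L : ℝ) ^ (k + 1) * (2 * b)
          + 2 * ((56 * ((((d + 1 : ℕ) : ℝ)) * L) ^ 2 + 16 * (131072 * (((d + 1 : ℕ) : ℝ) + 1) ^ 2) * ((((d + 1 : ℕ) : ℝ)) * L)) * ((L : ℝ) ^ (k + 1) * (2 * b)) ^ 2)) ≤ cE →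
      (56 * ((((d + 1 : ℕ) : ℝ)) * L) ^ 2 + 16 * (131072 * (((d + 1 : ℕ) : ℝ) + 1) ^ 2) * ((((d + 1 : ℕ) : ℝ)) * L)) * ((L : ℝ) ^ (k + 1) * (2 * b)) ^ 2 ≤ ec →
      (eE + (2 * K * (L : ℝ) ^ (k + 1) * cE + 8 * K * (((L : ℝ) ^ (k + 1)) ^ 2 * x) * (frameC (d + 1) L * (L : ℝ) ^ (k + 1) * eE + ec) / (L : ℝ) ^ (k + 1)
          + 16 * K * ((d + 1 : ℕ) : ℝ) * (((L : ℝ) ^ (k + 1)) ^ 2 * x) * eE)) + (frameC (d + 1) L * (L : ℝ) ^ (k + 1) * eE + ec) / (L : ℝ) ^ (k + 1) ≤ δ₀ →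
      6 * ((d + 1 : ℕ) : ℝ) * (L : ℝ) ^ (k + 1) * δ₀ ≤ 1 / 10000 → (L : ℝ) ^ (k + 1) * δ₀ ≤ τ →
      2 * (L : ℝ) ^ (k + 1) * b + 24 * ((d + 1 : ℕ) : ℝ) * (L : ℝ) ^ (k + 1) * δ₀ ≤ S → S ≤ 1 / 10000 → S ≤ τ →
      2 * S + 6 * ((L : ℝ) ^ (k + 1) * δ₀) ≤ (L : ℝ) ^ (k + 1) * b₁ → 6 * S ≤ (L : ℝ) ^ (k + 1) * b₁ →
    ∃ ustar : Site (d + 1) → (Matrix n n ℂ)ˣ, IsUnitarySite ustar ∧ IsPeriodicSite ustar ((tower L N (k + 1) : ℕ) : ℤ) ∧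
      gaugeAct ustar U' = vary W (repLog W U' ustar) 1 ∧
      (∀ (y : Site (d + 1)) (κ : Fin (d + 1)), (L : ℝ) ^ (k + 1) * ‖repLog W U' ustar y κ‖ ≤ S) ∧
      (∀ z : Site (d + 1), ((ustar ((((L : ℤ) ^ (k + 1))) • z) : (Matrix n n ℂ)ˣ) : Matrix n n ℂ) = exp (cornerLog L k ustar z)) ∧
      (∀ z : Site (d + 1), ‖cornerLog L k ustar z‖ ≤ S) ∧
      tangentPartNL0 hL k hWu hx hs hWx N hθ hE U' ustar ∈ energyBlockLandauW (d := d + 1) (n := n) L N (k + 1) W ∧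
      (∀ z, mlog ((vcov L W (relPert W (repLog W U' ustar)) (k + 1) z : (Matrix n n ℂ)ˣ) : Matrix n n ℂ)
        = cornerLog L k ustar z + framePotW L (k + 1) W (normalPartNL0 hL k hWu hx hs hWx N hθ hE U' ustar) z) ∧
      (∀ z, mlog ((vcov L W (relPert W (repLog W U' ustar)) (k + 1) z : (Matrix n n ℂ)ˣ) : Matrix n n ℂ) = cornerLog L k ustar z) ∧
      sliceDefectNL0 hL k hWu hx hs hWx N hθ hE U' ustar = 0 := by
  obtain ⟨K, hK, ε₀, hε₀, hcurved⟩ := curved_sup_letter (n := n) hd hL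
  refine ⟨K, hK, min ε₀ (1 / (32 * K * ((d + 1 : ℕ) : ℝ) + 1)), lt_min hε₀ (by positivity), ?_⟩
  intro k N _ W U' x hWu hx hs hWx hθ hE hWP hU'u hU'P κ₀ α₀ αP x' b b₁ ω hα hα3 hα4 h52 hsmall hc₃ h100 hC16 hsm hsmall2 hc₃2 h1002 hC162 hsm2 hαP hαP3 hαP2 hx'0 hU'x hx'P hω0 hβ
    hθP hε1 hε hA hθc τ hτ0 hτ1 hτs hC h4 h5 u₀ hu₀ hu₀P hpin hb hb64 eE cE ec δ₀ S heE hcE hec hδ₀ hδmax hMδ hSsum hS4 hSτ hSb h6S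
  have hε0' : ((L : ℝ) ^ (k + 1)) ^ 2 * x ≤ ε₀ := hε1.trans (min_le_left _ _)
  have hKε : 16 * K * ((d + 1 : ℕ) : ℝ) * (((L : ℝ) ^ (k + 1)) ^ 2 * x) ≤ 1 / 2 := by
    have h1 : ((L : ℝ) ^ (k + 1)) ^ 2 * x ≤ 1 / (32 * K * ((d + 1 : ℕ) : ℝ) + 1) := hε1.trans (min_le_right _ _)
    have hpos : 0 < 32 * K * ((d + 1 : ℕ) : ℝ) + 1 := by positivity
    have h2 : 16 * K * ((d + 1 : ℕ) : ℝ) * (1 / (32 * K * ((d + 1 : ℕ) : ℝ) + 1)) ≤ 1 / 2 := by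
      rw [mul_one_div, div_le_iff₀ hpos]; nlinarith only [hK.le, (Nat.cast_nonneg (d + 1) : (0:ℝ) ≤ ((d + 1 : ℕ) : ℝ))]
    exact (mul_le_mul_of_nonneg_left h1 (by positivity : (0 : ℝ) ≤ 16 * K * ((d + 1 : ℕ) : ℝ))).trans h2
  have hLet : ∀ Y : Site (d + 1) → Fin (d + 1) → Matrix n n ℂ, Y ∈ energyBlockLandauW (d := d + 1) (n := n) L N (k + 1) W →
      ∀ B : ℝ, (∀ (z : Site (d + 1)) (μ ν : Fin (d + 1)), μ ≠ ν → ‖curlAt W Y z μ ν‖ ≤ B) → ∀ (y : Site (d + 1)) (κ : Fin (d + 1)), ‖Y y κ‖ ≤ K * (L : ℝ) ^ (k + 1) * B :=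
    fun Y hY B hB y κ => hcurved k N W x hWu hWP hx hs hWx hε0' Y hY B hB y κ
  exact slice_theorem_nl (d := d + 1) hL k hWu hx hs hWx N hθ hE U' hWP hU'u hU'P (Nat.succ_le_succ (Nat.zero_le d)) κ₀ hα hα3 hα4 h52 hsmall hc₃ h100 hC16 hsm hsmall2 hc₃2 h1002 hC162 hsm2
    hαP hαP3 hαP2 hx'0 hU'x hx'P hω0 hβ hθP hK.le hKε hLet hε hA hθc hτ0 hτ1 hτs hC h4 h5 hu₀ hu₀P hpin hb hb64 heE hcE hec hδ₀ hδmax hMδ hSsum hS4 hSτ hSb h6S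

end

end Summit.QuantumFields.BalabanUV.T4Continuum.NE7SliceTheoremNL0Curved
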